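import Mathlib.Tactic
import HarnessLib

/-!
# LSM-Z-2D for every TWO-COPY de Finetti law (the first genuinely multi-type case)

Support file for the Sahi / Conjecture-P programme of route `PercNearOneGluingNoHeavy`
(`--supports stmt-CriticalPhenomena-4575`, prover prim-l12-p5 gen 29; proof note
`prim-l12-p5/MULTITYPE-g29.md` §0, §4.4).  No definitions, no named facts, no sorries.

A multi-type de Finetti bi-exchangeable law with integer rates is a finite set of unit copies `τ` with
hit probabilities `(p_τ, q_τ) ∈ [0,1]²`; its two-block cycle partition function is
`Zc(a,c) = (a+c-1)!·G(a,c)`, `G(a,c) = ∑_{(i,l)≠0} e_{il}·(a)_i (c)_l/(i+l-1)!` (`e_{il}` the mixed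
elementary symmetric polynomials of the copies), and LSM-Z-2D (`Zc` is TP₂) reads
`(a+c)·G(a+1,c)G(a,c+1) ≤ (a+c+1)·G(a+1,c+1)G(a,c)`.  For TWO copies `(p₁,q₁), (p₂,q₂)` (two distinct
unit-rate types, or one type of rate 2, or a type plus a sure anchor)
`G(a,c) = a(p₁+p₂) + c(q₁+q₂) + p₁p₂·a(a-1) + (p₁q₂+p₂q₁)·ac + q₁q₂·c(c-1)`.

* `two_copy_lsm` : the inequality for all real `a, c ≥ 0` and all `p_i, q_i ∈ [0,1]`, by an explicit
  Bernstein-type certificate: the difference is a polynomial in `(a,c)` whose every coefficient is a sum of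
  products of `p_i, q_i, 1-p_i, 1-q_i` (MULTITYPE-g29 §4.4; `ring` checks the identity).
-/

namespace Summit.CriticalPhenomena.PercolationContinuityZ3.Theorems

namespace TwoCopyLSM

/-- **LSM-Z-2D for every two-copy de Finetti law.**  With
`G(a,c) = a(p₁+p₂) + c(q₁+q₂) + p₁p₂a(a-1) + (p₁q₂+p₂q₁)ac + q₁q₂c(c-1)`:
`(a+c)·G(a+1,c)·G(a,c+1) ≤ (a+c+1)·G(a+1,c+1)·G(a,c)` for all real `a, c ≥ 0`, `p_i, q_i ∈ [0,1]`. -/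
theorem two_copy_lsm (a c p₁ q₁ p₂ q₂ : ℝ) (ha : 0 ≤ a) (hc : 0 ≤ c) (hp₁ : 0 ≤ p₁) (hp₁' : p₁ ≤ 1)
    (hq₁ : 0 ≤ q₁) (hq₁' : q₁ ≤ 1) (hp₂ : 0 ≤ p₂) (hp₂' : p₂ ≤ 1) (hq₂ : 0 ≤ q₂) (hq₂' : q₂ ≤ 1) :
    (a + c) *
        ((a + 1) * (p₁ + p₂) + c * (q₁ + q₂) + p₁ * p₂ * ((a + 1) * a) + (p₁ * q₂ + p₂ * q₁) * ((a + 1) * c) +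
          q₁ * q₂ * (c * (c - 1))) *
        (a * (p₁ + p₂) + (c + 1) * (q₁ + q₂) + p₁ * p₂ * (a * (a - 1)) + (p₁ * q₂ + p₂ * q₁) * (a * (c + 1)) +
          q₁ * q₂ * ((c + 1) * c)) ≤
    (a + c + 1) *
        ((a + 1) * (p₁ + p₂) + (c + 1) * (q₁ + q₂) + p₁ * p₂ * ((a + 1) * a) +
          (p₁ * q₂ + p₂ * q₁) * ((a + 1) * (c + 1)) + q₁ * q₂ * ((c + 1) * c)) *
        (a * (p₁ + p₂) + c * (q₁ + q₂) + p₁ * p₂ * (a * (a - 1)) + (p₁ * q₂ + p₂ * q₁) * (a * c) +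
          q₁ * q₂ * (c * (c - 1))) := by
  set P₁ := 1 - p₁ with hP₁
  set Q₁ := 1 - q₁ with hQ₁
  set P₂ := 1 - p₂ with hP₂
  set Q₂ := 1 - q₂ with hQ₂
  have hP₁0 : 0 ≤ P₁ := by linarith
  have hQ₁0 : 0 ≤ Q₁ := by linarith
  have hP₂0 : 0 ≤ P₂ := by linarith
  have hQ₂0 : 0 ≤ Q₂ := by linarith
  rw [← sub_nonneg]
  -- the certificate (MULTITYPE-g29 §4.4): coefficient of a^α c^γ
  have key :
      (a + c + 1) *
          ((a + 1) * (p₁ + p₂) + (c + 1) * (q₁ + q₂) + p₁ * p₂ * ((a + 1) * a) +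
            (p₁ * q₂ + p₂ * q₁) * ((a + 1) * (c + 1)) + q₁ * q₂ * ((c + 1) * c)) *
          (a * (p₁ + p₂) + c * (q₁ + q₂) + p₁ * p₂ * (a * (a - 1)) + (p₁ * q₂ + p₂ * q₁) * (a * c) +
            q₁ * q₂ * (c * (c - 1))) -
        (a + c) *
          ((a + 1) * (p₁ + p₂) + c * (q₁ + q₂) + p₁ * p₂ * ((a + 1) * a) + (p₁ * q₂ + p₂ * q₁) * ((a + 1) * c) +
            q₁ * q₂ * (c * (c - 1))) *
          (a * (p₁ + p₂) + (c + 1) * (q₁ + q₂) + p₁ * p₂ * (a * (a - 1)) + (p₁ * q₂ + p₂ * q₁) * (a * (c + 1)) +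
            q₁ * q₂ * ((c + 1) * c)) =
      a ^ 4 * (p₁ ^ 2 * p₂ ^ 2) + a ^ 3 * c * (2 * p₁ * p₂ * (q₁ * p₂ + p₁ * q₂)) +
        a ^ 2 * c ^ 2 * ((q₁ * p₂ + p₁ * q₂) ^ 2 + 2 * p₁ * p₂ * q₁ * q₂) +
        a * c ^ 3 * (2 * q₁ * q₂ * (p₁ * q₂ + q₁ * p₂)) + c ^ 4 * (q₁ ^ 2 * q₂ ^ 2) +
        a ^ 3 * (2 * p₁ * p₂ * (p₁ + p₂)) +
        a ^ 2 * c * (2 * q₁ * p₂ ^ 2 + q₁ ^ 2 * p₂ ^ 2 + p₁ ^ 2 * q₂ ^ 2 + 2 * p₁ ^ 2 * q₂ + 4 * p₁ * p₂ * q₂ +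
          2 * p₁ * p₂ * q₁ * (1 + Q₂)) +
        a * c ^ 2 * (2 * p₁ * q₂ ^ 2 + p₁ ^ 2 * q₂ ^ 2 + q₁ ^ 2 * p₂ ^ 2 + 2 * q₁ ^ 2 * p₂ + 4 * q₁ * q₂ * p₂ +
          2 * q₁ * q₂ * p₁ * (1 + P₂)) +
        c ^ 3 * (2 * q₁ * q₂ * (q₁ + q₂)) +
        a ^ 2 * (p₂ ^ 2 * (1 + q₁ * P₁) + p₁ ^ 2 * (1 + q₂ * P₂) + 2 * p₁ * p₂ + p₁ * p₂ * (p₁ * P₂ + p₂)) +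
        a * c * (2 * p₂ * q₂ + 2 * p₁ * q₁ + 2 * q₁ * p₂ ^ 2 * P₁ + 2 * q₁ ^ 2 * p₂ * Q₂ + q₁ ^ 2 * p₂ ^ 2 +
          2 * p₁ * q₂ ^ 2 * Q₁ + 2 * p₁ ^ 2 * q₂ * P₂ + p₁ ^ 2 * q₂ ^ 2 + 2 * q₁ * p₂ + 2 * p₁ * q₂) +
        c ^ 2 * (q₂ ^ 2 * (1 + p₁ * Q₁) + q₁ ^ 2 * (1 + p₂ * Q₂) + 2 * q₁ * q₂ + q₁ * q₂ * (q₁ * Q₂ + q₂)) +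
        a * (p₂ ^ 2 * (P₁ * (1 + q₁)) + p₁ ^ 2 * (P₂ * (1 + q₂)) + 2 * p₁ * p₂) +
        c * (q₂ ^ 2 * (Q₁ * (1 + p₁)) + q₁ ^ 2 * (Q₂ * (1 + p₂)) + 2 * q₁ * q₂) := by
    rw [hP₁, hQ₁, hP₂, hQ₂]
    ring
  rw [key]
  positivity

end TwoCopyLSM

end Summit.CriticalPhenomena.PercolationContinuityZ3.Theorems
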